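import Literature.Probability.RandomPlanarGeometry.ObservableLimitPassage
import HarnessLib

/-!
# The spin-1/3 (percolation) half-plane observable: far-field expansion and short-time continuity

Topic `Literature/Probability/RandomPlanarGeometry` (deterministic chordal Loewner calculus;
theorems only, no definition, no named fact). Percolation (`κ = 6`) companion of
`LoewnerFarField.lean` / `ObservableShortTime.lean` (FK-Ising observable, exponent `1/2`,
`κ = 16/3`) and of their spin-Ising appendices (`κ = 3`).

The half-plane martingale observable of the chordal exploration of critical percolation is the
spin-`1/3` parafermion: in the slit half-plane uniformized by `g_t`, driving value `W_t`, it is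
(up to a `t`-independent factor) the principal CUBE ROOT of the Loewner density,
`(z g_t'(z)/(g_t(z) - W_t))^{1/3}` (Duminil-Copin, J. Phys. A 45 (2012) 494013 =
arXiv:1208.3787, p. 9: the parafermionic observable of spin `σ = 1/3` at `q = 1` and its
scaling limit; Duminil-Copin–Smirnov, Clay Math. Proc. 15 (2012), §8.3, and the proof of
Prop. 6.7 for the FK method; Chelkak–Duminil-Copin–Hongler–Kemppainen–Smirnov, C. R. Math. 352
(2014), §3). There is deliberately NO new definition here: every statement is written with
the explicit expression `(z * deriv (map W t) z / (map W t z - W t)) ^ (3 : ℂ)⁻¹`, so that it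
applies by `rfl` to any definition with this body (e.g. the percolation routes'
`paraObservable` / `paraObservableProcess` of the summit `CriticalPhenomena`). Results, all
PROVED:

* `norm_cpow_third_one_add_sub_le` — the second-order expansion of the principal cube root,
  `(1+ε)^{1/3} = 1 + ε/3 - ε²/9 + O(ε³)` for `‖ε‖ ≤ 1/4`, without power series
  (`(s - p)(s² + sp + p²) = s³ - p³` and `Re`-positivity of `s`, `s²`);
* `FarRegime.norm_paraObservable_sub_le` — **the far-field expansion**
  `‖(z g_t'/(g_t - W_t))^{1/3} - (1 + W_t/(3z) + (2W_t² - 12t)/(9z²))‖ ≤ 64 α³`,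
  `α = (K + √t)/‖z‖ ≤ 1/64`, from the tree's expansion of the density
  `1 + W_t/z + (W_t² - 4t)/z² + O(α³)` (`FarRegime.norm_density_sub_le`). At `z = iy` the two
  coefficients are `-W_t/(3y)` (imaginary part) and `-(2/9)(W_t² - 6t)/y²` (real part): the
  martingales `W_t` and `W_t² - 6t`, i.e. `κ = 6`;
* `ShortTime.continuousOn_paraObservable`, `ShortTime.norm_paraObservable_le`,
  `continuous_paraObservable_min`, `norm_paraObservable_min_le` — in CDHKS's short-time regime
  `9t ≤ y²` the density at `iy` stays in the slit plane (`ShortTime.base_mem_slitPlane`), so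
  the principal cube root is the branch continuous in `t` from `1`, bounded by `2`;
* `continuous_paraObservable_min_cdhksTime` — joint continuity of the time-limited observable
  in (time, driving path) on `[0, ∞) × C([0, ∞), ℝ)` (from `continuous_base_min_cdhksTime`),
  the input of the limit passage `integral_cylinder_eq_zero_of_discreteMartingales`.

Consumers: `ParaObservableProcess.lean`, `ParaObservableLocalMartingale.lean`,
`ParaObservableLimitPassage.lean`, `ParaObservableSLESix.lean` (the `κ = 6` twin of
`LatticeModels.isSLELaw_three_of_limitData`).

## Mathlib

USED: `Complex.cpow_ofNat_inv_pow` (`(w^{1/3})³ = w`), `Complex.cpow_def_of_ne_zero`,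
`Complex.exp_re`, `Complex.abs_arg_lt_pi_div_two_iff`, `Complex.norm_cpow_real`,
`Real.pow_rpow_inv_natCast`, `ContinuousOn.cpow_const`, `Complex.continuousAt_cpow_const`.

## References

* H. Duminil-Copin, *Divergence of the correlation length for critical planar FK percolation
  with `1 ≤ q ≤ 4` via parafermionic observables*, J. Phys. A 45 (2012) 494013
  (arXiv:1208.3787), p. 9.
* H. Duminil-Copin, S. Smirnov, *Conformal invariance of lattice models*, Clay Math. Proc. 15
  (2012), §8.3 and proof of Prop. 6.7.
* D. Chelkak, H. Duminil-Copin, C. Hongler, A. Kemppainen, S. Smirnov, *Convergence of Ising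
  interfaces to Schramm's SLE curves*, C. R. Math. Acad. Sci. Paris 352 (2014), §3.
-/

noncomputable section

open Set Filter Topology Metric MeasureTheory Complex
open scoped NNReal

namespace Literature.Probability.RandomPlanarGeometry

namespace Loewner

/-! ### Elementary expansions of the principal cube root -/

section Elementary

/-- The principal cube root `s = w^{1/3}` of a number with positive real part, and its square,
have positive real part: `arg s = (arg w)/3 ∈ (-π/6, π/6)`. [folklore] -/
theorem re_cpow_third_pos {w : ℂ} (hw : 0 < w.re) :
    0 < (w ^ ((3 : ℂ)⁻¹)).re ∧ 0 < ((w ^ ((3 : ℂ)⁻¹)) ^ 2).re := by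
  have hw0 : w ≠ 0 := fun h => by simp [h] at hw
  have harg := abs_lt.1 (abs_arg_lt_pi_div_two_iff.2 (Or.inl hw))
  have him : (log w * (3 : ℂ)⁻¹).im = arg w / 3 := by
    rw [show ((3 : ℂ)⁻¹) = ((3⁻¹ : ℝ) : ℂ) by norm_num, mul_comm, im_ofReal_mul, log_im]
    ring
  rw [cpow_def_of_ne_zero hw0]
  constructor
  · rw [exp_re]
    refine mul_pos (Real.exp_pos _) (Real.cos_pos_of_mem_Ioo ⟨?_, ?_⟩)
    · rw [him]; linarith [Real.pi_pos]
    · rw [him]; linarith [Real.pi_pos]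
  · rw [sq, ← exp_add, exp_re]
    have him2 : (log w * (3 : ℂ)⁻¹ + log w * (3 : ℂ)⁻¹).im = 2 * arg w / 3 := by
      rw [add_im, him]; ring
    refine mul_pos (Real.exp_pos _) (Real.cos_pos_of_mem_Ioo ⟨?_, ?_⟩)
    · rw [him2]; linarith [Real.pi_pos]
    · rw [him2]; linarith [Real.pi_pos]

/-- `‖(1+ε)^{1/3} - 1‖ ≤ ‖ε‖` for `‖ε‖ < 1` (principal branch): with `s = (1+ε)^{1/3}`,
`(s - 1)(s² + s + 1) = ε` and `Re (s² + s + 1) > 1`. [folklore] -/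
theorem norm_cpow_third_one_add_sub_one_le {ε : ℂ} (hε : ‖ε‖ < 1) :
    ‖(1 + ε) ^ ((3 : ℂ)⁻¹) - 1‖ ≤ ‖ε‖ := by
  have hre : 0 < (1 + ε).re := by
    have : |ε.re| ≤ ‖ε‖ := abs_re_le_norm ε
    have := (abs_le.1 this).1
    simp only [add_re, one_re]
    linarith
  obtain ⟨hsre, hs2re⟩ := re_cpow_third_pos hre
  have hcube : ((1 + ε) ^ ((3 : ℂ)⁻¹)) ^ 3 = 1 + ε := cpow_ofNat_inv_pow _ 3
  set s := (1 + ε) ^ ((3 : ℂ)⁻¹) with hs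
  have hfac : (s - 1) * (s ^ 2 + s + 1) = ε := by linear_combination hcube
  have h1 : 1 ≤ ‖s ^ 2 + s + 1‖ := by
    calc (1 : ℝ) ≤ (s ^ 2 + s + 1).re := by simp only [add_re, one_re]; linarith
      _ ≤ ‖s ^ 2 + s + 1‖ := re_le_norm _
  have h2 : ‖s - 1‖ * ‖s ^ 2 + s + 1‖ = ‖ε‖ := by rw [← norm_mul, hfac]
  nlinarith [norm_nonneg (s - 1), norm_nonneg (s ^ 2 + s + 1)]

/-- **Second-order expansion of the principal cube root**:
`‖(1+ε)^{1/3} - (1 + ε/3 - ε²/9)‖ ≤ ‖ε‖³` for `‖ε‖ ≤ 1/4`. Proof without power series: with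
`s = (1+ε)^{1/3}` and `p = 1 + ε/3 - ε²/9`, `(s - p)(s² + sp + p²) = (5/27)ε³ - ε⁵/81 + ε⁶/729`
and `‖s² + sp + p² - 3‖ ≤ 3/2` (`‖s - 1‖ ≤ ‖ε‖`). [folklore] -/
theorem norm_cpow_third_one_add_sub_le {ε : ℂ} (hε : ‖ε‖ ≤ 1 / 4) :
    ‖(1 + ε) ^ ((3 : ℂ)⁻¹) - (1 + ε / 3 - ε ^ 2 / 9)‖ ≤ ‖ε‖ ^ 3 := by
  have hε1 : ‖ε‖ < 1 := by linarith
  have hδ := norm_cpow_third_one_add_sub_one_le hε1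
  have hcube : ((1 + ε) ^ ((3 : ℂ)⁻¹)) ^ 3 = 1 + ε := cpow_ofNat_inv_pow _ 3
  set s := (1 + ε) ^ ((3 : ℂ)⁻¹) with hs
  set p : ℂ := 1 + ε / 3 - ε ^ 2 / 9 with hp
  set δ : ℂ := s - 1 with hδdef
  set a : ℂ := ε / 3 - ε ^ 2 / 9 with ha
  have hfac : (s - p) * (s ^ 2 + s * p + p ^ 2) = 5 / 27 * ε ^ 3 - ε ^ 5 / 81 + ε ^ 6 / 729 := by
    rw [hp]
    linear_combination hcube
  have hsd : s = 1 + δ := by rw [hδdef]; ring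
  have hpa : p = 1 + a := by rw [hp, ha]; ring
  have hε0 := norm_nonneg ε
  have ha_le : ‖a‖ ≤ 1 / 9 := by
    calc ‖a‖ ≤ ‖ε / 3‖ + ‖ε ^ 2 / 9‖ := norm_sub_le _ _
      _ = ‖ε‖ / 3 + ‖ε‖ ^ 2 / 9 := by simp [norm_pow]
      _ ≤ (1 / 4) / 3 + (1 / 4) ^ 2 / 9 := by gcongr
      _ ≤ 1 / 9 := by norm_num
  have hδ' : ‖δ‖ ≤ 1 / 4 := hδ.trans hε
  have hQ : s ^ 2 + s * p + p ^ 2 = 3 + (3 * δ + 3 * a + δ ^ 2 + δ * a + a ^ 2) := by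
    rw [hsd, hpa]; ring
  have hR : ‖3 * δ + 3 * a + δ ^ 2 + δ * a + a ^ 2‖ ≤ 3 / 2 := by
    calc ‖3 * δ + 3 * a + δ ^ 2 + δ * a + a ^ 2‖
        ≤ ‖3 * δ‖ + ‖3 * a‖ + ‖δ ^ 2‖ + ‖δ * a‖ + ‖a ^ 2‖ := by
          refine (norm_add_le _ _).trans ?_
          gcongr
          refine (norm_add_le _ _).trans ?_
          gcongr
          refine (norm_add_le _ _).trans ?_
          gcongr
          exact norm_add_le _ _
      _ = 3 * ‖δ‖ + 3 * ‖a‖ + ‖δ‖ ^ 2 + ‖δ‖ * ‖a‖ + ‖a‖ ^ 2 := by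
          simp [norm_pow]
      _ ≤ 3 * (1 / 4) + 3 * (1 / 9) + (1 / 4) ^ 2 + (1 / 4) * (1 / 9) + (1 / 9) ^ 2 := by
          gcongr
      _ ≤ 3 / 2 := by norm_num
  have hQlow : 3 / 2 ≤ ‖s ^ 2 + s * p + p ^ 2‖ := by
    rw [hQ]
    have := norm_sub_norm_le (3 : ℂ) (-(3 * δ + 3 * a + δ ^ 2 + δ * a + a ^ 2))
    rw [norm_neg, sub_neg_eq_add] at this
    have h3 : ‖(3 : ℂ)‖ = 3 := by simp
    linarith
  have hrhs : ‖5 / 27 * ε ^ 3 - ε ^ 5 / 81 + ε ^ 6 / 729‖ ≤ ‖ε‖ ^ 3 * (3 / 2) / 4 := by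
    calc ‖5 / 27 * ε ^ 3 - ε ^ 5 / 81 + ε ^ 6 / 729‖
        ≤ ‖5 / 27 * ε ^ 3‖ + ‖ε ^ 5 / 81‖ + ‖ε ^ 6 / 729‖ :=
          (norm_add_le _ _).trans (by gcongr; exact norm_sub_le _ _)
      _ = 5 / 27 * ‖ε‖ ^ 3 + ‖ε‖ ^ 5 / 81 + ‖ε‖ ^ 6 / 729 := by simp [norm_pow]
      _ = ‖ε‖ ^ 3 * (5 / 27 + ‖ε‖ ^ 2 / 81 + ‖ε‖ ^ 3 / 729) := by ring
      _ ≤ ‖ε‖ ^ 3 * (5 / 27 + (1 / 4) ^ 2 / 81 + (1 / 4) ^ 3 / 729) := by gcongr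
      _ ≤ ‖ε‖ ^ 3 * (3 / 2) / 4 := by nlinarith [pow_nonneg hε0 3]
  have hprod : ‖s - p‖ * ‖s ^ 2 + s * p + p ^ 2‖ ≤ ‖ε‖ ^ 3 * (3 / 2) / 4 := by
    rw [← norm_mul, hfac]; exact hrhs
  have h0 : 0 ≤ ‖ε‖ ^ 3 := by positivity
  nlinarith [norm_nonneg (s - p), norm_nonneg (s ^ 2 + s * p + p ^ 2)]

/-- The norm of a principal cube root is the cube root of the norm. [folklore] -/
theorem norm_cpow_three_inv (b : ℂ) : ‖b ^ ((3 : ℂ)⁻¹)‖ = ‖b‖ ^ (3⁻¹ : ℝ) := by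
  rw [show ((3 : ℂ)⁻¹) = ((3⁻¹ : ℝ) : ℂ) by norm_num, norm_cpow_real]

/-- `x^{1/3} ≤ 2` for `0 ≤ x ≤ 8`. [folklore] -/
theorem rpow_three_inv_le_two {x : ℝ} (hx0 : 0 ≤ x) (hx : x ≤ 8) : x ^ (3⁻¹ : ℝ) ≤ 2 := by
  calc x ^ (3⁻¹ : ℝ) ≤ (8 : ℝ) ^ (3⁻¹ : ℝ) := Real.rpow_le_rpow hx0 hx (by norm_num)
    _ = 2 := by
        rw [show (8 : ℝ) = 2 ^ 3 by norm_num, show (3⁻¹ : ℝ) = ((3 : ℕ) : ℝ)⁻¹ by norm_num,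
          Real.pow_rpow_inv_natCast (by norm_num) (by norm_num)]

end Elementary

/-! ### Far-field expansion of the spin-1/3 observable -/

namespace FarRegime

variable {W : ℝ≥0 → ℝ} {z : ℂ} {t : ℝ≥0} {K : ℝ}

/-- **Second-order far-field expansion of the spin-1/3 observable** (percolation, `κ = 6`): for
a continuous driving function `W` with `|W_s| ≤ K` on `[0, t]` and `64 (K + √t) ≤ ‖z‖`,
`‖(z g_t'(z)/(g_t(z) - W_t))^{1/3} - (1 + W_t/(3z) + (2W_t² - 12t)/(9z²))‖ ≤ 64 ((K + √t)/‖z‖)³`: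
the density is `1 + u` with `u = W_t/z + (W_t² - 4t)/z² + O(α³)` (`norm_density_sub_le`) and
`(1+u)^{1/3} = 1 + u/3 - u²/9 + O(u³)`. On the imaginary axis the two coefficients `W_t` and
`(2/9)(W_t² - 6t)` separate into imaginary and real part — whence the martingales `W_t`,
`W_t² - 6t` of a chain whose observable is a martingale, i.e. `κ = 6`.
[cite: DuminilCopin2012Parafermion, p. 9] -/
theorem norm_paraObservable_sub_le (h : FarRegime W z t K) :
    ‖((z * deriv (map W t) z /
          (map W t z - ((W t : ℝ) : ℂ))) ^ ((3 : ℂ)⁻¹)) - (1 + W t / (3 * z) + (2 * (W t : ℂ) ^ 2 - 12 * t) / (9 * z ^ 2))‖ ≤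
      64 * ((K + Real.sqrt t) / ‖z‖) ^ 3 := by
  obtain ⟨g, hg⟩ := h.exists_sol
  have hK := h.K_le
  have ht := h.t_le
  have hα := h.alpha_le
  have hα0 := h.alpha_nonneg
  have hmain := h.norm_density_sub_le hg
  have hN1 := h.norm_density_sub_one_le
  have hWt : ‖(W t : ℂ)‖ ≤ K := by
    rw [norm_real, Real.norm_eq_abs]
    have := h.bound t ⟨t.coe_nonneg, le_rfl⟩
    rwa [Real.toNNReal_coe] at this
  set α := (K + Real.sqrt t) / ‖z‖ with hαdef
  have hρ := h.pos
  have hz := h.z_ne_zero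
  set N := z * deriv (map W t) z / (map W t z - W t) with hNdef
  set ε := N - 1 with hεdef
  set w : ℂ := (W t : ℂ) / z with hwdef
  set c : ℂ := ((W t : ℂ) ^ 2 - 4 * t) / z ^ 2 with hcdef
  have hw : ‖w‖ ≤ α := by
    rw [hwdef, norm_div, div_le_iff₀ hρ]; exact hWt.trans hK
  have hc : ‖c‖ ≤ 5 * α ^ 2 := by
    rw [hcdef, norm_div, norm_pow, div_le_iff₀ (by positivity)]
    calc ‖(W t : ℂ) ^ 2 - 4 * t‖ ≤ ‖(W t : ℂ) ^ 2‖ + ‖(4 : ℂ) * t‖ := norm_sub_le _ _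
      _ = ‖(W t : ℂ)‖ ^ 2 + 4 * t := by
          rw [norm_pow, norm_mul]
          congr 1
          rw [Complex.norm_real, Real.norm_eq_abs, abs_of_nonneg t.coe_nonneg]
          simp
      _ ≤ (α * ‖z‖) ^ 2 + 4 * (α ^ 2 * ‖z‖ ^ 2) := by
          gcongr
          exact hWt.trans hK
      _ = 5 * α ^ 2 * ‖z‖ ^ 2 := by ring
  have hR5 : ‖ε - (w + c)‖ ≤ 100 * α ^ 3 := by
    have : ε - (w + c) = N - (1 + W t / z + ((W t : ℂ) ^ 2 - 4 * t) / z ^ 2) := by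
      rw [hεdef, hwdef, hcdef]; ring
    rw [this]; exact hmain
  have hε : ‖ε‖ ≤ 2 * α := hN1
  have hε' : ‖ε‖ ≤ 1 / 4 := by linarith
  have hcbrt := norm_cpow_third_one_add_sub_le hε'
  have hobs : ((z * deriv (map W t) z /
        (map W t z - ((W t : ℝ) : ℂ))) ^ ((3 : ℂ)⁻¹)) = (1 + ε) ^ ((3 : ℂ)⁻¹) := by
    rw [hεdef, hNdef]; ring_nf
  -- `ε² - w²`
  have hε2 : ‖ε ^ 2 - w ^ 2‖ ≤ 21 * α ^ 3 := by
    have hid : ε ^ 2 - w ^ 2 = (ε - w) * (ε + w) := by ring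
    have h1 : ‖ε - w‖ ≤ 7 * α ^ 2 := by
      calc ‖ε - w‖ = ‖(ε - (w + c)) + c‖ := by ring_nf
        _ ≤ ‖ε - (w + c)‖ + ‖c‖ := norm_add_le _ _
        _ ≤ 100 * α ^ 3 + 5 * α ^ 2 := add_le_add hR5 hc
        _ ≤ 7 * α ^ 2 := by nlinarith [pow_le_pow_left₀ hα0 hα 2]
    have h2 : ‖ε + w‖ ≤ 3 * α := by
      calc ‖ε + w‖ ≤ ‖ε‖ + ‖w‖ := norm_add_le _ _
        _ ≤ 2 * α + α := add_le_add hε hw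
        _ = 3 * α := by ring
    rw [hid, norm_mul]
    calc ‖ε - w‖ * ‖ε + w‖ ≤ (7 * α ^ 2) * (3 * α) := by gcongr
      _ = 21 * α ^ 3 := by ring
  -- the target in terms of `w`, `c`
  have hT : (1 : ℂ) + W t / (3 * z) + (2 * (W t : ℂ) ^ 2 - 12 * t) / (9 * z ^ 2) =
      1 + (w + c) / 3 - w ^ 2 / 9 := by
    rw [hwdef, hcdef]; field_simp; ring
  rw [hobs, hT]
  have hid : (1 + ε) ^ ((3 : ℂ)⁻¹) - (1 + (w + c) / 3 - w ^ 2 / 9) =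
      ((1 + ε) ^ ((3 : ℂ)⁻¹) - (1 + ε / 3 - ε ^ 2 / 9)) + (ε - (w + c)) / 3 - (ε ^ 2 - w ^ 2) / 9 := by
    ring
  rw [hid]
  calc ‖((1 + ε) ^ ((3 : ℂ)⁻¹) - (1 + ε / 3 - ε ^ 2 / 9)) + (ε - (w + c)) / 3 - (ε ^ 2 - w ^ 2) / 9‖
      ≤ ‖(1 + ε) ^ ((3 : ℂ)⁻¹) - (1 + ε / 3 - ε ^ 2 / 9)‖ + ‖(ε - (w + c)) / 3‖ +
          ‖(ε ^ 2 - w ^ 2) / 9‖ :=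
        (norm_sub_le _ _).trans (by gcongr; exact norm_add_le _ _)
    _ = ‖(1 + ε) ^ ((3 : ℂ)⁻¹) - (1 + ε / 3 - ε ^ 2 / 9)‖ + ‖ε - (w + c)‖ / 3 +
          ‖ε ^ 2 - w ^ 2‖ / 9 := by
        simp
    _ ≤ ‖ε‖ ^ 3 + 100 * α ^ 3 / 3 + 21 * α ^ 3 / 9 := by gcongr
    _ ≤ (2 * α) ^ 3 + 100 * α ^ 3 / 3 + 21 * α ^ 3 / 9 := by gcongr
    _ ≤ 64 * α ^ 3 := by nlinarith [pow_nonneg hα0 3]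

end FarRegime

/-! ### The short-time regime: continuity in time and boundedness -/

namespace ShortTime

variable {W : ℝ≥0 → ℝ} {t : ℝ≥0}

/-- **The spin-1/3 observable `s ↦ (iy g_s'(iy)/(g_s(iy) - W_s))^{1/3}` is continuous on
`[0, t]`** in the short-time regime `9t ≤ y²`: the density stays in the slit plane
(`base_mem_slitPlane`), where the principal cube root is continuous — the branch "continuous in
`t` from the value `1` at `t = 0`". [folklore] -/
theorem continuousOn_paraObservable {y : ℝ} (h : ShortTime W (I * y) t) :
    ContinuousOn (fun s : ℝ≥0 ↦ (((I * y) * deriv (map W s) (I * y) /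
          (map W s (I * y) - ((W s : ℝ) : ℂ))) ^ ((3 : ℂ)⁻¹))) (Icc 0 t) :=
  h.continuousOn_base.cpow_const fun _ hs ↦ (h.mono hs.2).base_mem_slitPlane

/-- **The spin-1/3 observable is bounded by `2`** on the imaginary axis in the short-time
regime: `‖iy g'/(g - W)‖ ≤ y · 2/((2/3) y) = 3` and `3^{1/3} ≤ 2`. [folklore] -/
theorem norm_paraObservable_le {y : ℝ} (h : ShortTime W (I * y) t) : ‖(((I * y) * deriv (map W t) (I * y) /
      (map W t (I * y) - ((W t : ℝ) : ℂ))) ^ ((3 : ℂ)⁻¹))‖ ≤ 2 := by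
  have hy : 0 < y := by simpa using h.im_pos
  set b := I * y * deriv (map W t) (I * y) / (map W t (I * y) - W t) with hb
  have hbase : ‖b‖ ≤ 3 := by
    have hG := h.norm_map_sub_lower
    have hIy : (I * (y : ℂ)).im = y := by simp
    rw [hIy] at hG
    have hG0 : 0 < ‖map W t (I * y) - W t‖ := by linarith
    rw [hb, norm_div, norm_mul, div_le_iff₀ hG0]
    have h1 : ‖I * (y : ℂ)‖ = y := by simp [abs_of_pos hy]
    rw [h1]
    have h2 := h.norm_deriv_map_le
    nlinarith [norm_nonneg (deriv (map W t) (I * y))]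
  rw [norm_cpow_three_inv]
  exact rpow_three_inv_le_two (norm_nonneg _) (by linarith)

end ShortTime

variable {W : ℝ≥0 → ℝ}

/-- **The time-limited path `s ↦ (observable at time s ∧ T(iy))` is continuous on `[0, ∞)`**
(`W` continuous, `y > 0`, `T(iy) = y²/9`). [folklore] -/
theorem continuous_paraObservable_min (hW : Continuous W) {y : ℝ} (hy : 0 < y) :
    Continuous fun s : ℝ≥0 ↦ (((I * y) * deriv (map W (min s (cdhksTime y))) (I * y) /
          (map W (min s (cdhksTime y)) (I * y) - ((W (min s (cdhksTime y)) : ℝ) : ℂ))) ^ ((3 : ℂ)⁻¹)) :=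
  (shortTime_cdhksTime hW hy).continuousOn_paraObservable.comp_continuous
    (continuous_id.min continuous_const) fun _ ↦ ⟨bot_le, min_le_right _ _⟩

/-- The time-limited spin-1/3 observable is bounded by `2`. [folklore] -/
theorem norm_paraObservable_min_le (hW : Continuous W) {y : ℝ} (hy : 0 < y) (s : ℝ≥0) :
    ‖(((I * y) * deriv (map W (min s (cdhksTime y))) (I * y) /
          (map W (min s (cdhksTime y)) (I * y) - ((W (min s (cdhksTime y)) : ℝ) : ℂ))) ^ ((3 : ℂ)⁻¹))‖ ≤ 2 :=
  (shortTime_min_cdhksTime hW hy s).norm_paraObservable_le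

/-- **The time-limited spin-1/3 observable is jointly continuous in (time, driving path)** on
`[0, ∞) × C([0, ∞), ℝ)`: the principal cube root is continuous at the density
`b_{u ∧ T(iy)}(w)`, which lies in the slit plane, and the density is jointly continuous
(`continuous_base_min_cdhksTime`). [folklore] -/
theorem continuous_paraObservable_min_cdhksTime {y : ℝ} (hy : 0 < y) :
    Continuous fun p : ℝ≥0 × C(ℝ≥0, ℝ) ↦ (((I * y) * deriv (map p.2 (min p.1 (cdhksTime y))) (I * y) /
          (map p.2 (min p.1 (cdhksTime y)) (I * y) - ((p.2 (min p.1 (cdhksTime y)) : ℝ) : ℂ))) ^ ((3 : ℂ)⁻¹)) := by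
  have hb := continuous_base_min_cdhksTime hy
  rw [continuous_iff_continuousAt] at hb ⊢
  intro p
  have hmem := (shortTime_min_cdhksTime p.2.continuous hy p.1).base_mem_slitPlane
  exact ContinuousAt.comp (g := fun x : ℂ ↦ x ^ ((3 : ℂ)⁻¹)) (continuousAt_cpow_const hmem) (hb p)

end Loewner

end Literature.Probability.RandomPlanarGeometry
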